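/-
Copyright (c) 2026 the pub-hodgecm-mathlib formalisation cell (harness21).  Prover seat hodgecm-mathlib-F0P3-p02 (g27), 2026-09-03.  E1 row 63 RIDER «REALISE + SCHUR-PAIR AT THE
CM BOREL TRIPLE» (E1 keeper ∕ dealer F0P3a-p03 (g30) 03:54:44Z «the datum application is yours too»; generic half ★ `IrreducibleEmbeddingSchurPair` p853497).
-/
import Literature.NumberTheory.Automorphic.IrreducibleEmbeddingSchurPair                 -- ★ row 63 (this seat): `IrrClass.exists_realisation_schurPair`; brings ★ `UnitaryGroup.deltaChar_cmBorelTriple_eq_one_of_mem_N`, `cmBorelTriple`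
import HarnessLib

/-!
# F0 · P3c · line LH6 «StCharTS» — E1 row 63 RIDER: REALISE + SCHUR-PAIR for `i_B(χ)` on `U(Φ₃)(L⁺_v)` (★ row 63 (4) at `t := cmBorelTriple L 3 v`, `hδ` discharged)

Cell `pub/hodgecm-mathlib` (D-0151), crux H413 = `stmt-HodgeConjecture-24833`; lane `--kind proof --supports stmt-HodgeConjecture-24833 --as helper` (THEOREMS ONLY: no definition ∕
instance ∕ notation ∕ named fact ∕ `sorry`; count-neutral: closes no node).  Namespace `Summit.HodgeConjecture.HodgeConjecture.Cruxes.H413.F0P3cStCharTSPiTwoRealisation`.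
HONEST LABEL: E1 = PRINT until the keeper's charter test; h413 OPEN; HC_CM is proved only modulo the printed citations (2 remaining named inputs hLiu418 =
stmt-HodgeConjecture-24832, h413 = stmt-HodgeConjecture-24833) until rung 0 closes; nothing printed is asserted here.

THE MATHEMATICS ([Rogawski1990 §12.2 (2)]; [Casselman1995 Thm 3.2.4, Cor. 6.3.9, Cor. 7.1.2]; [Bump1997 Prop. 4.2.4]).  The ★ 40 D DATUM PATTERN (`F0P3cStCharTSK2PiTwoSelfExtSplit` §2:
the place data `L, v`, the Borel triple `t := cmBorelTriple L 3 v` of `G_v = U(Φ₃)(L⁺_v)`, an ABSTRACT character `χ` of its Levi `T(L⁺_v) = t.M` — so that the statement elaborates at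
default heartbeats; the `Gqs`∕`cmXiTorusChar` letters of ★ `F0P3KeysLabelledPair.labelledPair_of_reducible` are supplied by the consumer in ITS proof, where their `10⁷`-node carrier is
already elaborated).  For `I₀ := i_B(χ) = normalizedInd t (𝟙 ⊗ χ)` (`= cmPrincipalSeries L 3 v χ` by `rfl`, ★ `principalSeries`; its admissibility `hadm` a hypothesis = ★ `isAdmissible_cmPrincipalSeries L v χ` at the consumer, `χ` read on `torusU`; `δ_B|_N = 1`
★ `deltaChar_cmBorelTriple_eq_one_of_mem_N` DISCHARGED) of length two with labelled constituents `πs ≠ πn` (`r_B(πs) ≅ ℂ_χ`, `r_B(πn) ≅ ℂ_{θ₁}` — at `χ = χ_ξ`: `πs = π²(ξ)`, `πn = πⁿ(ξ)`, `θ₁ = wχ_ξ`,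
★ `labelledPair_of_reducible`) and a compact open `K ≤ G_v`: ★ row 63 (4) REALISES `πs` as a `G`-stable `A ≤ i_B(χ)` with the letters `(A hAinv hAirr hHom0 hSchur)` of ★ 40″
`selfExtension_splits_of_jacquet_selfExtension` at `χ₁ := 𝟙 ⊗ χ` (the printed orientation: `π²(ξ) ⊂ i_B(χ_ξ)`, `πⁿ(ξ)` the quotient) and (d2a′) `r_B(i_B(χ)∕A) ≠ 0`.

* `exists_realisation_schurPair_cmBorel` — the one head.
[cite: Rogawski1990, §12.2 (2) pp. 173–174] [cite: Casselman1995, Thm 3.2.4, Cor. 6.3.9, Cor. 7.1.2] [cite: Bump1997, Proposition 4.2.4] [cite: Keys1984, §3 pp. 118–119]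

## References
* [Rogawski1990] J. D. Rogawski, *Automorphic Representations of Unitary Groups in Three Variables*, Ann. of Math. Stud. 123 (1990): §12.2 (2) pp. 173–174.
* [Casselman1995] W. Casselman, *Introduction to the theory of admissible representations of p-adic reductive groups* (1995): Thm 3.2.4, Cor. 6.3.9, Cor. 7.1.2.
* [Bump1997] D. Bump, *Automorphic Forms and Representations* (1997): Proposition 4.2.4.
* [Keys1984] D. Keys, *Principal series representations of special unitary groups over local fields*, Compositio Math. 51 (1984): §3 pp. 118–119.
-/

set_option autoImplicit false

set_option linter.dupNamespace false

noncomputable section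

open NumberField IsDedekindDomain

namespace Summit.HodgeConjecture.HodgeConjecture.Cruxes.H413.F0P3cStCharTSPiTwoRealisation

open Literature.NumberTheory.Automorphic Literature.NumberTheory.Automorphic.UnitaryGroup
open Summit.HodgeConjecture.HodgeConjecture.Cruxes.H413

variable (L : Type) [Field L] [NumberField L] [IsCMField L] (v : HeightOneSpectrum (𝓞 ↥(maximalRealSubfield L)))
  [LocallyCompactSpace ↥(borelU (conjLocal L (IsCMField.complexConj L) v) (cmLocalForm L 3 v))]

set_option maxHeartbeats 400000 in  -- the statement AND the one call each elaborate under the default 200000 at the CM carrier, not together (measured; cf. ★ `F0P3cStCharTSJetAtDatum` §3's identical budget)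
/-- **ROW 63 ON `U(Φ₃)(L⁺_v)` — `πs ↪ i_B(χ)` REALISED WITH ITS SCHUR PAIR** (★ row 63 (4) `IrrClass.exists_realisation_schurPair` at `t := cmBorelTriple L 3 v`, with `δ_B|_N = 1` ★
`deltaChar_cmBorelTriple_eq_one_of_mem_N` DISCHARGED).  Hypotheses: `χ θ₁` characters of `T(L⁺_v)`, `hadm` (= ★ `isAdmissible_cmPrincipalSeries L v χ` at the consumer), `K ≤ G_v` compact
open, `i_B(χ)` of length two (`hlen`) with constituents exactly `πn ≠ πs` (`hJH`) carrying `r_B(πs) ≅ ℂ_χ` (`hs`), `r_B(πn) ≅ ℂ_{θ₁}` (`hn`) — the conclusion of ★ `labelledPair_of_reducible`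
at `χ := χ_ξ`, `θ₁ := wχ_ξ`.  Conclusion: a `G`-stable `A ≤ i_B(χ)` with `hAirr`, `hHom0`, `hSchur` — EXACTLY the SENTENCE's letters.  The class labels `⟦A⟧ = πs`, `⟦i_B(χ)∕A⟧ = πn` and (d2a′)
`Nontrivial (r_B(i_B(χ)∕A))` of the generic ★ (4) are NOT re-stated at the datum: `IsIrreducible` ∕ `Coinvariants` of a sub∕quotient of the CM carrier do not elaborate at default
heartbeats (the ★ J2 §3 whnf wall) — a consumer reads them off ★ (4) inside its own proof, where the carrier is already elaborated.
[cite: Rogawski1990, §12.2 (2) pp. 173–174] [cite: Casselman1995, Thm 3.2.4, Cor. 6.3.9, Cor. 7.1.2] [cite: Bump1997, Proposition 4.2.4] -/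
theorem exists_realisation_schurPair_cmBorel (χ θ₁ : ↥(cmBorelTriple L 3 v).M →* ℂˣ)
    (hadm : (Representation.normalizedInd (cmBorelTriple L 3 v) ((Representation.trivial ℂ ↥(cmBorelTriple L 3 v).M ℂ).twist χ)).IsAdmissible)
    {K : Subgroup ↥(unitaryGroupOfForm (conjLocal L (IsCMField.complexConj L) v) (cmLocalForm L 3 v))}
    (hKo : IsOpen (K : Set ↥(unitaryGroupOfForm (conjLocal L (IsCMField.complexConj L) v) (cmLocalForm L 3 v))))
    (hKc : IsCompact (K : Set ↥(unitaryGroupOfForm (conjLocal L (IsCMField.complexConj L) v) (cmLocalForm L 3 v))))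
    (hlen : ∀ N₁ N₂ : Subrepresentation (Representation.normalizedInd (cmBorelTriple L 3 v) ((Representation.trivial ℂ ↥(cmBorelTriple L 3 v).M ℂ).twist χ)),
      ¬ (⊥ < N₁ ∧ N₁ < N₂ ∧ N₂ < ⊤))
    {πs πn : IrrClass ↥(unitaryGroupOfForm (conjLocal L (IsCMField.complexConj L) v) (cmLocalForm L 3 v))} (hne : πs ≠ πn)
    (hJH : ∀ c : IrrClass ↥(unitaryGroupOfForm (conjLocal L (IsCMField.complexConj L) v) (cmLocalForm L 3 v)),
      c.IsConstituentOf (Representation.normalizedInd (cmBorelTriple L 3 v) ((Representation.trivial ℂ ↥(cmBorelTriple L 3 v).M ℂ).twist χ)) ↔ (c = πn ∨ c = πs))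
    (hs : ∃ r : SmoothIrrep ↥(unitaryGroupOfForm (conjLocal L (IsCMField.complexConj L) v) (cmLocalForm L 3 v)), IrrClass.mk r = πs ∧
      Nonempty ((r.ρ.normalizedJacquet (cmBorelTriple L 3 v)).Equiv ((Representation.trivial ℂ ↥(cmBorelTriple L 3 v).M ℂ).twist χ)))
    (hn : ∃ r : SmoothIrrep ↥(unitaryGroupOfForm (conjLocal L (IsCMField.complexConj L) v) (cmLocalForm L 3 v)), IrrClass.mk r = πn ∧
      Nonempty ((r.ρ.normalizedJacquet (cmBorelTriple L 3 v)).Equiv ((Representation.trivial ℂ ↥(cmBorelTriple L 3 v).M ℂ).twist θ₁))) :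
    ∃ (A : Submodule ℂ (Representation.SmoothInd (cmBorelTriple L 3 v).P
          (Representation.twist (((Representation.trivial ℂ ↥(cmBorelTriple L 3 v).M ℂ).twist χ).comp (cmBorelTriple L 3 v).proj) (rootDeltaChar (cmBorelTriple L 3 v).P))))
      (hAinv : ∀ g, A ≤ A.comap (Representation.normalizedInd (cmBorelTriple L 3 v) ((Representation.trivial ℂ ↥(cmBorelTriple L 3 v).M ℂ).twist χ) g)),
      (∀ B : Submodule ℂ _, B ≤ A →
          (∀ g, B ≤ B.comap (Representation.normalizedInd (cmBorelTriple L 3 v) ((Representation.trivial ℂ ↥(cmBorelTriple L 3 v).M ℂ).twist χ) g)) → B = ⊥ ∨ B = A) ∧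
      (∀ ψ : Representation.IntertwiningMap
          ((Representation.normalizedInd (cmBorelTriple L 3 v) ((Representation.trivial ℂ ↥(cmBorelTriple L 3 v).M ℂ).twist χ)).subrepresentation A hAinv)
          ((Representation.normalizedInd (cmBorelTriple L 3 v) ((Representation.trivial ℂ ↥(cmBorelTriple L 3 v).M ℂ).twist χ)).quotient A hAinv), ψ = 0) ∧
      Module.finrank ℂ (Representation.IntertwiningMap
          ((Representation.normalizedInd (cmBorelTriple L 3 v) ((Representation.trivial ℂ ↥(cmBorelTriple L 3 v).M ℂ).twist χ)).subrepresentation A hAinv)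
          ((Representation.normalizedInd (cmBorelTriple L 3 v) ((Representation.trivial ℂ ↥(cmBorelTriple L 3 v).M ℂ).twist χ)).subrepresentation A hAinv)) = 1 := by
  -- one call of ★ row 63 (4); the conjuncts are read off by projections (an `obtain` pattern against an `∃`-goal re-unifies the CM carrier and hits the whnf wall)
  have H := IrrClass.exists_realisation_schurPair (cmBorelTriple L 3 v) (deltaChar_cmBorelTriple_eq_one_of_mem_N L 3 v)
    hadm hKo hKc hlen hne hJH hs hn
  exact ⟨H.choose, H.choose_spec.choose, H.choose_spec.choose_spec.1, H.choose_spec.choose_spec.2.1, H.choose_spec.choose_spec.2.2.1⟩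

end Summit.HodgeConjecture.HodgeConjecture.Cruxes.H413.F0P3cStCharTSPiTwoRealisation

end
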